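import Summits.RiemannHypothesis.RiemannHypothesis.Theorems.LiTailLaguerreCompanions
import Summits.RiemannHypothesis.RiemannHypothesis.Theorems.LiTailLaguerreLiGammaTailShift
import HarnessLib

/-!
# RiemannHypothesis / LiTailLaguerre — TAIL SILENCE and the TAIL ECHO are theorems (RH-FREE PROOF-OF-DATA)

RH-FREE [rh-li-eng-4].  Cell `pub/rh-li`, theory round 7 (PART K `Theorems/LiTailLaguerreDefs.lean`).  With the binder K3′
`LiGammaTailShift` CLOSED·proved (`liGammaTailShift_proof`, rh-li-eng-2 g4) the compositions of
`Theorems/LiTailLaguerreCompanions.lean` discharge two typed companions of the leaf OUTRIGHT — without the deciding crux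
K2′ `LiPrimeTailLaguerre` and without any Laguerre/Fejér asymptotic:

* `liZeroTailSilent_holds : LiZeroTailSilent` — **TAIL SILENCE (T3f₀):** for every `c ≥ 5/4` there is `C` with
  `|liZeroTail n (c√n) − liSmoothTail n (c√n)| ≤ C log² n` for all `n ≥ 2`: the zeros ABOVE height `c√n`, Li-weighted
  (whatever their real parts), equal their Riemann–von Mangoldt mean up to `O(log² n)`.  DATA it explains: ET2 j248301
  (DATA.md §H: `c ∈ {1.25, 1.5, 2, 3}`, band rms 0.7–2.3, sup ≤ 4.9 over `n ∈ [10³, 10⁷]`).  Inputs: K1′ `liTailContour_proof`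
  (half-strip contour identity), K3′ `liGammaTailShift_proof`, K4′ `liTailHorizontal_proof`, the BC5 rung
  `RungSilent.stub_rung_silent` (prime tail `O(log n)` for `c ≥ 5/4` by the first-derivative test), and the supports
  `liPolarTailBound`, `liTailAdjust`.
* `liZeroTailEcho_holds : LiZeroTailEcho` — **TAIL ECHO (T3f):** `|liZeroTail n √n − liSmoothTail n √n − E₂(n)| ≤ C log² n`:
  the zeros above `√n` carry the FULL chirp `+A₂ n^{1/4} cos(2√(n log 2) + π/4)` of the prime `2`.  DATA it explains: ET2
  j248301 at `c = 1` (corr(D, +E₂) = 0.88…0.99) and this base seat's lineage F / Z-echo tables (DATA.md §F/§M, `fl − P₅₀ =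
  O(1)`).  Inputs: tail silence at `c = 5/4`, the PROVED round-6 window law `liZeroWindowEcho_proof`, and Backlund's
  `N = θ/π + 1 + S` with `|S(T)| ≤ 0.3083 log T + 3.24`.

Labels: RH-FREE for all `n`; PROOF-OF-DATA; NOT height-buying.  WHAT THIS IS NOT: not evidence for RH and not RH-sensitive —
every zero is summed whatever its real part; nothing here bears on the truth of RH.
-/

noncomputable section

-- D-0017: `Summit.<S>.<S>.…` is the designed namespace of a single-problem summit.
set_option linter.dupNamespace false

namespace Summit.RiemannHypothesis.RiemannHypothesis.Theorems.LiTheory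

/-- **TAIL SILENCE (PART K companion `LiZeroTailSilent`, T3f₀) holds — RH-FREE PROOF-OF-DATA.** -/
theorem liZeroTailSilent_holds : LiZeroTailSilent :=
  liZeroTailSilent_of_gammaShift liGammaTailShift_proof

/-- **TAIL ECHO (PART K companion `LiZeroTailEcho`, T3f) holds — RH-FREE PROOF-OF-DATA:** the zeros above `√n` carry the
full echo `+E₂(n)` of the prime `2`, up to `O(log² n)`. -/
theorem liZeroTailEcho_holds : LiZeroTailEcho :=
  liZeroTailEcho_of_gammaShift liGammaTailShift_proof

end Summit.RiemannHypothesis.RiemannHypothesis.Theorems.LiTheory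

end
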